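import Summits.BirchSwinnertonDyer.BirchSwinnertonDyer.Theorems.ByReductionTypeAtTwoRankOneAtTwoOneDoorLawCDefs
import HarnessLib

/-!
# Cell `bsd-f1-sign2`, lens `-an` g12 (MEMO-an v1.22 §2 AN-29): TWIN VALUATION FLOOR, ITS SHARPNESS, AND THE 2-SELMER RANK READ OFF
# THE DOOR-TWISTED CENTRAL VALUES — rows AN-29a `DoorTwinSelmerFloorAtTwo`, AN-29b `DoorTwinSelmerFloorSharpAtTwo`, headline AN-29
# `LeastTwinValuationAtTwo`, AN-29c `DoorTwinValuationParityAtTwo` (all `@[conjecture]`), helpers, kernel glue, REF1 e1–e4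
# (the Zhao / Zhai / CLTZ «integrality across the twist family» half of the analytic lens)

The object.  For `W/ℚ` globally minimal with `E(ℚ)[2] = 0` and a door-admissible `d` (tree `DoorAdmissible`: `d < 0`
square-free, `d ≡ 1 (8)`, every `q ∣ d` good, `(d/ℓ) = 1` at the odd bad `ℓ`) with `L(W^{(d)},1) ≠ 0`, the ALGEBRAIC TWIN VALUE
`q_d := L(W_d, 1)/Ω(W_d) ∈ ℚ` of a globally minimal model `W_d` of the twist (`Ω` = Miller's period incl. `c_∞`,
tree `realPeriodRat`), and its normalised `2`-adic valuation `A(W,d) := ord₂ q_d − ord₂ ∏_ℓ c_ℓ(W)`.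

* AN-29a `DoorTwinSelmerFloorAtTwo` (CONJECTURE; the EULER-SYSTEM HALF of rank-`0` `BSD₂` on the door family, `Ш(W_d)`-FREE,
  sharpened by the BASE curve's `2`-Selmer group):  `A(W,d) ≥ max (t + 2s, dim_{𝔽₂} Sel₂(W) − [Δ_W > 0])`.
  Mechanism: `BSD₂(W_d)` gives `A = t + 2s + ord₂ #Ш(W_d)[2^∞]` (Tate `I₀*` at the door primes: `c_q(W_d) = 2` at the `t`
  transposition primes, `4` at the `s` identity primes; `W_d ≅ W` over `ℚ_ℓ` at `ℓ ∣ 2N`); `#Ш(W_d)[2^∞] ≥ #Ш(W_d)[2] = #Sel₂(W_d)`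
  (rank `0`, no `2`-torsion); and the DROP LEMMA `dim Sel₂(W_d) ≥ dim Sel₂(W) − t − 2s − [Δ_W > 0]` (the two Selmer groups live in
  `H¹(ℚ, W[2])` with the same local conditions away from the non-silent door primes and, for `Δ_W > 0`, the real place, where the
  two Kummer Lagrangians are transverse: Kramer 1981 Prop. 3 and 6, Mazur–Rubin 2010 Prop. 3.3).  So AN-29a ⟸ [Kato-direction
  inequality `ord₂ q_d ≥ ord₂ ∏c(W_d) + dim Sel₂(W_d)` at `p = 2` for the non-CM rank-`0` twin, ALL reduction types at `2`] ∧ [drop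
  lemma, kernel algebra].  The first is in print only for odd `p` (Kato 2004 Thm 17.4 / Perrin-Riou 2003 Prop 4.8, `p ≠ 2`); the
  cell's ES-C-E `KatoRankZeroUpperBoundAtTwo` is its good-supersingular-at-`2`, full-`Ш` instance.
* AN-29b `DoorTwinSelmerFloorSharpAtTwo` (CONJECTURE; the CONVERSE HALF at a maximal-drop door): for `W` of analytic rank one the
  floor is ATTAINED: some door has `A(W,d) = dim Sel₂(W) − [Δ_W > 0]`.  ⟸ [Mazur–Rubin supply of a `Sel₂(W_d) = 0` door with
  `t + 2s = dim Sel₂(W) − [Δ>0]`] ∧ [the rank-`0` `2`-converse with exact valuation for `Sel₂`-trivial twins, `ord₂ q_d = ord₂ ∏c(W_d)`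
  — Zhai 2016 Thm 1.1's shape for a rank-`0` BASE; here the base has rank one and its plus modular symbols vanish].
* AN-29 `LeastTwinValuationAtTwo` = AN-29a(ii) ∧ AN-29b packaged: **`dim_{𝔽₂} Sel₂(W) − [Δ_W > 0] + ord₂ ∏c(W)` IS THE LEAST
  `ord₂ q_d` over the door twins with `L ≠ 0`** — an analytic formula for the `2`-Selmer rank of a rank-one curve with `E(ℚ)[2] = 0`.
* AN-29c `DoorTwinValuationParityAtTwo` (CONJECTURE, `Ш`-free square-class law): `A(W,d) ≡ [Δ_W < 0] (mod 2)` on every door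
  (⟸ `BSD₂(W_d)` ∧ Cassels–Tate squareness ∧ `t ≡ [Δ_W<0] (2)` = AN-22J, Hilbert reciprocity).
Census (ENGINE L kit j300076 + ENGINE L3 kit j303912, `MEMO-an-data/g12/census29.py` ab03d636a263616c → `census29.out` a2a9a784e12e03f6;
REF1 §100 independent recount `REF1-data/b100/recount29.py` from the raw rows `engineL_rows-j300076.jsonl` 52f2819d49a9eaee +
`engineL_rows-j303912.jsonl` 41237d1d7fc5e566): 1 029 DEDUPLICATED certified rank-`0` door rows on 294 curves (the sketch's «1 031» counted 2
duplicates — r2), 1 027 rows with `dim Sel₂(W) = 3`, 2 with `1`: AN-29a(i) 1 029/1 029 (equality 438), AN-29a(ii) 1 029/1 029 (equality 787;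
equality with the max 793; excess `ord₂ q_d − floorExp ∈ {0: 787, 2: 236, 4: 6}`, always even = AN-29c); AN-29b attained inside `|d| ≤ 6000` on
286/294 curves = 252/252 multi-door curves (the 8 misses are the 8 single-door curves); AN-29c 1 029/1 029; V3, drop lemma, door conditions
1 029/1 029; `v₂ Ш_an(W_d) = dim Sel₂(W_d)` on every row (no `Ш(W_d)[4]` in the data).  Nothing is asserted: `def … : Prop` only.

TYPER FILING (cell `bsd-f1-sign2`, seat `-ty` g9; CANDIDATES.md rows AN-29a / AN-29b / AN-29 / AN-29c; -an g12 CANDIDATES-delta 2026-08-28T10:14:08Z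
+ erratum 10:19:14Z, banking TURNKEY D-an-49 «bank `g12/Sketch_v18.lean` as `F1Sign2/TwinValuationFloorAtTwo.lean`», cell rule «file statement-only
AFTER REF1» — REF1 §100 CLEARED 11:57:26Z): the namespace block of `HOME/MEMO-an-data/g12/Sketch_v18.lean` 2d30917616108c07 (-an: farm rc 0 · 0 warn
· 0 sorry; BC7 4/4 CLEAN `g12/bc/Probe_v18.txt` 777003dccfe87d82) VERBATIM under the cell namespace `…Rank1Residual.F1Sign2.TwinFloor` — the four
rows tagged `@[conjecture]`, helper defs `posBit`/`negBit`/`selmerTwoDim`/`floorExp`/`twinValuations` and the two glue theorems unchanged — plus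
REF1's kernel facts e1–e4 of `REF1-data/b100/Probe100.lean` e06560555884a715 as theorems (proofs verbatim; names
`doorTwinSelmerFloorSharpAtTwo_of_leastTwinValuationAtTwo`, `floorExp_le_of_leastTwinValuationAtTwo`, `entireLFunction_ne_zero_of_floor`,
`floorExp_add_one_le_of_floor_of_parity`, `floorExp_sub_eq`).  Typer edits are DOCSTRING-ONLY: census count 1 031 ↦ 1 029 (r2), the AN-29b
«why it might fail» sentence (r1), riders r3/r5/r6/r7 and REF2 v24 §5 r1–r5, the REF1/REF2 verdict sentences, one cite key spelled as the bib
has it (`Cassels1962ArithmeticIV`), one added (`Zhai2021BSDExactFormulaTwists`, `Smith2022SelmerTwistI`).  The sketch's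
`import …Theses.ByReductionTypeAtTwo` / `HarnessLib.Audit.CruxProbe` (probe-only) are not imported.
REF1-AUDIT §100 (refuter-bsd-f1-sign2-ref1 g9): AN-29a/b/headline/c SURVIVE as typed (conj-grade: BSD₂ of the rank-0 door twins + Kolyvagin +
drop lemma (a), + maximal-drop door supply (b), + Cassels–Tate + AN-22J (c); ¬CM scope-only), KILLED none; Probe100 e06560555884a715 rc 0·0·0·0,
glue + e1–e4 trio; independent recount from raw ENGINE L/L3 rows 1 029/1 029 for a(i), a(ii), c, V3, drop lemma, door conditions; sharpness
286/294 (252/252 multi-door).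
REF2-PLACEMENT v24 §5 (refuter-bsd-f1-sign2-ref2 g24, D-an-50, 10:27:23Z): a(i) VARIANT (= weak 2-part BSD on the twin; unconditional printed
floor Zhai 2021 Thm 1.1: `ord₂ q_d ≥ t + s − 1` for optimal `W`); a(ii) + LeastTwinValuation NEW-COMBINATION (lower end: Zhai-type floors ×
Kramer/MR drop lemma, floor through the base's `Sel₂` not in print), OPEN IN PRINT as a theorem (Kato-exactness at 2, ES-C-E), BSD₂-implied;
b OPEN conjecture (MR 2010 Prop 5.2 supply + `Ш[4] = Ш[2]` at a door + rank-0 BSD₂), 286/294; c VARIANT (`ord₂ Ш_an(W_d)` even = square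
expectation), open; beyond-print theorem NO; not refuted in print; PARTITION none.
PARTITION: none (frontier tier, off the crux-23715 path); beyond-print theorem: no; BSD is not proved by any of this.
bears_on: the cell's SEARCH QUESTION («what is the signed / ± object at 2?») — the analytic lens's twist-family half; -an ask D-an-48 (Kato floor
with `Ш[2]` at `p = 2` for the rank-0 twin = ES-C-E `KatoRankZeroUpperBoundAtTwo`); D-an-47 (deep doors for the 8 single-door curves).
Builder `tools/mk_an29.py`, published with the filed text under `HOME/MEMO-ty-data/g9/`.
-/

set_option autoImplicit false

noncomputable section

open scoped Classical

namespace Summit.BirchSwinnertonDyer.Rank1Residual.F1Sign2.TwinFloor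

open Literature.NumberTheory.EllipticCurves Literature.NumberTheory.EllipticCurves.ModularForms
  Summit.BirchSwinnertonDyer.Rank1Residual.F1Sign2
  Summit.BirchSwinnertonDyer.BirchSwinnertonDyer.Theorems.RankOneAtTwoOneDoor

/-- `[Δ_W > 0]` as a natural number (`1` iff `E(ℝ)` has two components). -/
def posBit (W : WeierstrassCurve ℚ) : ℕ := if 0 < W.Δ then 1 else 0

/-- `[Δ_W < 0]` as a natural number. -/
def negBit (W : WeierstrassCurve ℚ) : ℕ := if W.Δ < 0 then 1 else 0

/-- `dim_{𝔽₂} Sel₂(W)` read off the tree's cardinality `selmerTwoCard W = #Sel₂(W)` (`Nat.log 2` = the EXACT `dim_{𝔽₂}` since `#Sel₂(W)` is a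
power of `2`; junk `0` if infinite — never: `Sel₂ ⊂ H¹(ℚ, W[2])` is finite by descent; REF1 §100 r6). -/
def selmerTwoDim (W : WeierstrassCurve ℚ) : ℕ := Nat.log 2 (selmerTwoCard W)

/-- The Selmer floor exponent `dim Sel₂(W) − [Δ_W > 0] + ord₂ ∏_ℓ c_ℓ(W)` (an integer; `≥ −1`). -/
def floorExp (W : WeierstrassCurve ℚ) : ℤ :=
  (selmerTwoDim W : ℤ) - posBit W + padicValNat 2 W.tamagawaProduct

/-- **AN-29a `DoorTwinSelmerFloorAtTwo` (CONJECTURE of the lens; Euler-system half of rank-`0` `BSD₂` on the door family,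
`Ш(W_d)`-free).**  For `W/ℚ` globally minimal, non-CM, `E(ℚ)[2] = 0`; every door-admissible `d` with `L(W^{(d)},1) ≠ 0`; every
globally minimal model `W_d` of the twist: `L(W_d,1)/Ω(W_d) = q_d ∈ ℚ^×` with
(i) `ord₂ q_d ≥ ord₂ ∏c(W) + t + 2s` (Tamagawa floor) and (ii) `ord₂ q_d ≥ ord₂ ∏c(W) + dim Sel₂(W) − [Δ_W > 0]` (Selmer floor).
Why it might fail: it is implied by BSD; as a THEOREM it needs Kato's divisibility at `p = 2` with no `2`-power loss for the twin
(printed `p ≠ 2`), and (ii) additionally the kernel drop lemma.  Census 1 029/1 029 deduplicated certified rank-`0` door rows on 294 curves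
(ENGINE L j300076 + L3 j303912; the sketch's «1 031» counted 2 duplicate rows — REF1 §100 r2).
RIDERS (REF1 §100 / REF2 v24 §5, docstring-only; the statement is the sketch's verbatim): (r3) `¬ W.HasCM` is used by none of the mechanism —
a SCOPE hypothesis (the cell is non-CM); (r5) `W` of ANY rank is covered and this is intended — (i) and (ii) are BSD₂(W_d)-implied in that
generality (the census is rank one: 1 027 rows with `dim Sel₂(W) = 3`, 2 with `1`); (e2) the conclusion ENTAILS `L(W_d,1) ≠ 0` for the MINIMAL
model `W_d` from the hypothesis on the naive twist model (`qd ≠ 0`; isomorphic models) — harmless; (REF2 r1/r2 = REF1 r7) next to (i): the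
UNCONDITIONAL printed floor is Zhai 2021 Thm 1.1 — `ord₂(L(E^{(M)},1)/c_∞(E^{(M)})) ≥ t_E(M) − 1 − ord₂ ν_E` for OPTIMAL `E` and square-free
`M ≡ 1 (4)`, `(M, C) = 1`; on a door `t_E(d) = t + s`, so print gives `ord₂ q_d ≥ t + s − 1` for `W` optimal in its class or odd-isogenous to the
optimal curve (`E(ℚ)[2] = 0` ⇒ only odd isogenies, which move `L/c_∞` by odd factors); the name «weak form of the 2-part of BSD» is Zhai 2020
(MPCPS 168); (REF2 r3) `q_d` uses `Ω(W_d)` of a minimal model of the twist INCLUDING `c_∞` — the `Ω(E^{(d)})` vs `Ω(E)/√|d|` relation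
(«often misstated») is not used; (REF2 r5) drop lemma: Kramer 1981 Prop 3 + Mazur–Rubin 2010 Lemmas 2.9–2.11.
REF1 §100 (g9, D-an-50, 2026-08-28T11:57:26Z): SURVIVES as typed (conj-grade = BSD₂ for the rank-`0` twin + Kolyvagin + drop lemma), CLEARED;
independent recount from raw ENGINE L/L3 rows: door conditions, `(t,s)`, V3 `v₂∏c(W_d) = v₂∏c(W) + t + 2s`, (i) (equality 438), (ii) (equality
787; excess `ord₂ q_d − floorExp ∈ {0: 787, 2: 236, 4: 6}`), drop lemma — all 1 029/1 029.  REF2 v24 §5: (i) VARIANT (= weak 2-part of BSD on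
the twin; nearest theorem Zhai 2021 Thm 1.1); (ii) NEW-COMBINATION (lower end: Zhai-type floors × Kramer/MR drop lemma — a floor through the
BASE's `Sel₂` not located in print), OPEN IN PRINT as a theorem at `2` (missing input = Kato floor with `Ш[2]` at `p = 2` on the rank-`0` twin,
all types = ES-C-E, D-an-48), BSD₂-implied; not refuted in print.  PARTITION: none (frontier tier, off the 23715 path); beyond-print theorem: no.
[cite: Kato2004, Thm. 17.4] [cite: PerrinRiou2003, Prop. 4.8] [cite: Kramer1981, Prop. 3] [cite: MazurRubin2010, Prop. 3.3]
[cite: Zhai2021BSDExactFormulaTwists, Thm. 1.1] -/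
@[conjecture] def DoorTwinSelmerFloorAtTwo : Prop :=
  ∀ (W : WeierstrassCurve ℚ) [W.IsElliptic] [W.IsGloballyMinimal], ¬ W.HasCM → NoRationalTwoTorsion W →
    ∀ (d : ℤ), DoorAdmissible W d → (W.quadraticTwist (d : ℚ)).entireLFunction 1 ≠ 0 →
      ∀ (Wd : WeierstrassCurve ℚ) [Wd.IsElliptic] [Wd.IsGloballyMinimal] (Cd : WeierstrassCurve.VariableChange ℚ),
        Cd • W.quadraticTwist (d : ℚ) = Wd →
        ∃ qd : ℚ, Wd.entireLFunction 1 / (Wd.realPeriodRat : ℂ) = (qd : ℂ) ∧ qd ≠ 0 ∧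
          ((padicValNat 2 W.tamagawaProduct + transpCount W d + 2 * identCount W d : ℕ) : ℤ) ≤ padicValRat 2 qd ∧
          floorExp W ≤ padicValRat 2 qd

/-- **AN-29b `DoorTwinSelmerFloorSharpAtTwo` (CONJECTURE of the lens; the converse half at a maximal-drop door).**  For `W/ℚ`
globally minimal, non-CM, `E(ℚ)[2] = 0`, of analytic rank one, SOME door-admissible `d` with `L(W^{(d)},1) ≠ 0` and some globally
minimal model of the twist attain the Selmer floor: `ord₂ q_d = ord₂ ∏c(W) + dim Sel₂(W) − [Δ_W > 0]`.
Why it might fail: needs a `Sel₂`-trivialising door with `t + 2s = dim Sel₂(W) − [Δ>0]` (Mazur–Rubin + Chebotarev, in print) AND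
the rank-`0` `2`-converse with exact valuation for that twin (open in print at `p = 2` for non-CM); it fails iff NO door with
`L(W_d,1) ≠ 0` realises the maximal Selmer drop `Sel₂(W_d) = 0` — at such a door `Ш(W_d)[2^∞] = 0` automatically and BSD₂ gives equality, so
the failure mode is SUPPLY (or BSD₂), not `Ш[4]` (REF1 §100 r1 wording; the sketch's sentence «a curve all of whose maximal-drop twins carry
`Ш(W_d)[4] ≠ 0`-type excess would refute it» named an impossible failure mode).  Census: attained within `|d| ≤ 6000` on 286/294 curves =
252/252 curves with ≥ 2 usable doors; the 8 misses are exactly the 8 single-door curves (163060d1, 187198j1, 217917f1, 236547b1, 242514b1,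
446a1, 71374c1, 99378a1; D-an-47).
RIDERS: (REF2 r4) the Selmer-drop supply is Mazur–Rubin 2010 Props 5.1–5.3 (journal; = arXiv Props 34–36), the `Ш(W_d)[2^∞] = Ш(W_d)[2]`
distribution input is Smith 2022 I (Assumption 1.1 covers `E(ℚ)[2] = 0`) — neither is a printed ∃-theorem for the DOOR-restricted family with
`L ≠ 0`; parity bookkeeping (REF1 A2): a drop to `0` needs `t ≡ dim Sel₂(W) − [Δ>0] (2)` and AN-22J forces `t ≡ [Δ<0]`, so `dim Sel₂(W)` must be
ODD — which it is for `r_an = 1` unconditionally (GZK).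
REF1 §100: SURVIVES as typed (conj-grade = BSD₂ for rank-`0` twins + SUPPLY of a maximal-drop door with `L ≠ 0`), CLEARED with rider r1 (folded
above).  REF2 v24 §5: OPEN conjecture; as a statement VARIANT of «BSD₂ + Selmer-rank supply» (no new lever); 286/294; not refuted in print.
[cite: MazurRubin2010, Prop. 3.3 and Lemma 3.5] [cite: Zhai2016, Thm. 1.1] [cite: KrizLi2019, Thm. 1.1]
[cite: Smith2022SelmerTwistI, Assumption 1.1] -/
@[conjecture] def DoorTwinSelmerFloorSharpAtTwo : Prop :=
  ∀ (W : WeierstrassCurve ℚ) [W.IsElliptic] [W.IsGloballyMinimal], ¬ W.HasCM → NoRationalTwoTorsion W →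
    W.analyticRank = 1 →
    ∃ (d : ℤ) (Wd : WeierstrassCurve ℚ) (_ : Wd.IsElliptic) (_ : Wd.IsGloballyMinimal)
      (Cd : WeierstrassCurve.VariableChange ℚ) (qd : ℚ),
      DoorAdmissible W d ∧ (W.quadraticTwist (d : ℚ)).entireLFunction 1 ≠ 0 ∧ Cd • W.quadraticTwist (d : ℚ) = Wd ∧
      Wd.entireLFunction 1 / (Wd.realPeriodRat : ℂ) = (qd : ℂ) ∧ qd ≠ 0 ∧ padicValRat 2 qd = floorExp W

/-- The set of `2`-adic valuations `ord₂ (L(W_d,1)/Ω(W_d))` over the door twins of `W` with `L(W^{(d)},1) ≠ 0` (all globally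
minimal models `W_d`; the valuation does not depend on the model). -/
def twinValuations (W : WeierstrassCurve ℚ) [W.IsGloballyMinimal] : Set ℤ :=
  {v | ∃ (d : ℤ) (Wd : WeierstrassCurve ℚ) (_ : Wd.IsElliptic) (_ : Wd.IsGloballyMinimal)
      (Cd : WeierstrassCurve.VariableChange ℚ) (qd : ℚ),
      DoorAdmissible W d ∧ (W.quadraticTwist (d : ℚ)).entireLFunction 1 ≠ 0 ∧ Cd • W.quadraticTwist (d : ℚ) = Wd ∧
      Wd.entireLFunction 1 / (Wd.realPeriodRat : ℂ) = (qd : ℂ) ∧ qd ≠ 0 ∧ v = padicValRat 2 qd}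

/-- **AN-29 `LeastTwinValuationAtTwo` (headline; = AN-29a(ii) ∧ AN-29b): the `2`-SELMER RANK OF A RANK-ONE CURVE READ OFF ITS
DOOR-TWISTED CENTRAL VALUES.**  For `W/ℚ` globally minimal, non-CM, `E(ℚ)[2] = 0`, analytic rank one:
`dim_{𝔽₂} Sel₂(W) − [Δ_W > 0] + ord₂ ∏c(W)` is the LEAST element of `{ord₂ (L(W_d,1)/Ω(W_d)) : d door-admissible, L(W^{(d)},1) ≠ 0}`.
On the crux slice (`∏c` odd, rank one, no `2`-torsion): `dim_{𝔽₂} Ш(W)[2] = min_d ord₂ q_d − [Δ_W < 0]`.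
Why it might fail: either half (AN-29a(ii) Kato-direction at `2` for the twins; AN-29b converse at a maximal-drop door).
Census: floor 1 029/1 029 deduplicated rows (REF1 §100 r2), least element attained on 286/294 curves within `|d| ≤ 6000`.
REF1 §100: SURVIVES = AN-29a(ii)|_{r_an = 1} ∧ AN-29b EXACTLY (glue `leastTwinValuationAtTwo_of_floor_of_sharp` below + REF1 e1/e1′ =
`doorTwinSelmerFloorSharpAtTwo_of_leastTwinValuationAtTwo` / `floorExp_le_of_leastTwinValuationAtTwo` below), CLEARED as the headline; not
refutable by emptiness (for `r_an(W) = 1` door twists have root number `+1` and Bump–Friedberg–Hoffstein / Murty–Murty / Waldspurger give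
infinitely many door-class `d` with `L(W_d,1) ≠ 0`).  REF2 v24 §5: NEW-COMBINATION (lower end) with AN-29a(ii) — an ANALYTIC FORMULA for
`dim Sel₂(W)` as the least twin valuation, not located in print (nearest printed join: Zhai 2016 remark after Thm 1.1 + Boxer–Diao, rank-`0` base
with `Sel₂(E) = 0`); conjecture-grade, BSD₂ + supply-implied; OPEN IN PRINT as a theorem at `2`.  PARTITION (-an): rank-`0` BSD₂ on the door-twin
family = {AN-29a ES half} ⊔ {AN-29b exactness at a maximal-drop door}; cell PARTITION: none; beyond-print theorem: no.
[cite: Kato2004, Thm. 17.4] [cite: MazurRubin2010, Prop. 3.3] [cite: Zhai2016, Thm. 1.1] -/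
@[conjecture] def LeastTwinValuationAtTwo : Prop :=
  ∀ (W : WeierstrassCurve ℚ) [W.IsElliptic] [W.IsGloballyMinimal], ¬ W.HasCM → NoRationalTwoTorsion W →
    W.analyticRank = 1 → IsLeast (twinValuations W) (floorExp W)

/-- **AN-29c `DoorTwinValuationParityAtTwo` (CONJECTURE; `Ш`-free square-class law).**  Same binders as AN-29a:
`ord₂ q_d ≡ ord₂ ∏c(W) + [Δ_W < 0] (mod 2)` — the parity of the `2`-adic valuation of the algebraic central value is CONSTANT on the
door family.  ⟸ `BSD₂(W_d)` + Cassels–Tate (`#Ш(W_d)[2^∞]` a square) + `t ≡ [Δ_W < 0] (2)` (AN-22J, Hilbert reciprocity).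
Why it might fail: only through `BSD₂(W_d)`; a twin whose analytic `Ш` has odd `2`-adic valuation refutes it.  Census 1 029/1 029
deduplicated rows (REF1 §100 r2; 548 rows `Δ > 0`, 481 `Δ < 0`; AN-22J `t ≡ [Δ<0]` 1 029/1 029).
RIDERS: (r5) `W` of ANY rank is covered, intended (BSD₂(W_d) + Cassels–Tate + AN-22J in that generality); (r3) `¬HasCM` scope-only; (r4, REF1
e3/e4 = `floorExp_add_one_le_of_floor_of_parity` / `floorExp_sub_eq` below) AN-29a(ii) ∧ AN-29c ⇒ `ord₂ q_d ≥ floorExp W + 1` whenever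
`dim Sel₂(W)` is even — consistent with the headline's `r_an = 1` restriction.
REF1 §100: SURVIVES as typed (conj-grade = BSD₂(W_d) + Cassels–Tate + AN-22J), CLEARED.  REF2 v24 §5: VARIANT (`ord₂ Ш_an(W_d)` even = the
2-adic shadow of the printed square expectation; OPEN as a theorem even at rank `0` — Dokchitser–Dokchitser 2010 mod-squares results are on the
algebraic quotient); not refuted in print.
[cite: Cassels1962ArithmeticIV, Thm. 1.1] [cite: Kramer1981, Prop. 3] -/
@[conjecture] def DoorTwinValuationParityAtTwo : Prop :=
  ∀ (W : WeierstrassCurve ℚ) [W.IsElliptic] [W.IsGloballyMinimal], ¬ W.HasCM → NoRationalTwoTorsion W →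
    ∀ (d : ℤ), DoorAdmissible W d → (W.quadraticTwist (d : ℚ)).entireLFunction 1 ≠ 0 →
      ∀ (Wd : WeierstrassCurve ℚ) [Wd.IsElliptic] [Wd.IsGloballyMinimal] (Cd : WeierstrassCurve.VariableChange ℚ),
        Cd • W.quadraticTwist (d : ℚ) = Wd →
        ∃ qd : ℚ, Wd.entireLFunction 1 / (Wd.realPeriodRat : ℂ) = (qd : ℂ) ∧ qd ≠ 0 ∧
          Even (padicValRat 2 qd - padicValNat 2 W.tamagawaProduct - negBit W)

/-! ### Proved trivialities (plumbing, no content): the headline is exactly the two halves. -/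

/-- `IsLeast` unfolded: the floor exponent is a twin valuation and bounds every twin valuation from below (`Iff.rfl`). -/
theorem leastTwinValuation_iff_floor_and_sharp (W : WeierstrassCurve ℚ) [W.IsElliptic] [W.IsGloballyMinimal] :
    IsLeast (twinValuations W) (floorExp W) ↔
      (floorExp W ∈ twinValuations W ∧ ∀ v ∈ twinValuations W, floorExp W ≤ v) := by
  rfl

/-- AN-29a(ii) on every door + AN-29b ⇒ AN-29 (the packaging; pure logic). -/
theorem leastTwinValuationAtTwo_of_floor_of_sharp
    (hF : DoorTwinSelmerFloorAtTwo) (hS : DoorTwinSelmerFloorSharpAtTwo) : LeastTwinValuationAtTwo := by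
  intro W _ _ hCM hT hr
  refine ⟨?_, ?_⟩
  · obtain ⟨d, Wd, hE, hM, Cd, qd, hadm, hL, hmod, hq, hq0, hval⟩ := hS W hCM hT hr
    exact ⟨d, Wd, hE, hM, Cd, qd, hadm, hL, hmod, hq, hq0, hval.symm⟩
  · rintro v ⟨d, Wd, hE, hM, Cd, qd, hadm, hL, hmod, hq, hq0, rfl⟩
    obtain ⟨qd', hq', _, _, hfloor⟩ := hF W hCM hT d hadm hL Wd Cd hmod
    have : qd' = qd := by
      have h := hq'.symm.trans hq
      exact_mod_cast h
    subst this
    exact hfloor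

/-! ### REF1 §100 kernel facts e1–e4 (refuter-bsd-f1-sign2-ref1 g9, `REF1-data/b100/Probe100.lean` e06560555884a715, ns `REF1b100`;
proofs verbatim, names descriptive): headline ⇒ AN-29b and the rank-one floor; AN-29a entails `L ≠ 0` on the minimal model; the
parity-sharpened floor; the closed form of the parity offset.  Pure logic over the `def`s above. -/

/-- REF1 §100 e1: the headline already CONTAINS AN-29b (so AN-29 ⇔ AN-29a(ii)|_{r_an = 1} ∧ AN-29b, with the sketch's glue). -/
theorem doorTwinSelmerFloorSharpAtTwo_of_leastTwinValuationAtTwo (h : LeastTwinValuationAtTwo) : DoorTwinSelmerFloorSharpAtTwo := by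
  intro W _ _ hCM hT hr
  obtain ⟨⟨d, Wd, hE, hM, Cd, qd, hadm, hL, hmod, hq, hq0, hv⟩, _⟩ := h W hCM hT hr
  exact ⟨d, Wd, hE, hM, Cd, qd, hadm, hL, hmod, hq, hq0, hv.symm⟩

/-- REF1 §100 e1′: … and the floor half AN-29a(ii) restricted to analytic rank one. -/
theorem floorExp_le_of_leastTwinValuationAtTwo (h : LeastTwinValuationAtTwo) (W : WeierstrassCurve ℚ) [W.IsElliptic] [W.IsGloballyMinimal]
    (hCM : ¬ W.HasCM) (hT : NoRationalTwoTorsion W) (hr : W.analyticRank = 1) :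
    ∀ v ∈ twinValuations W, floorExp W ≤ v := fun _ hv => (h W hCM hT hr).2 hv

/-- REF1 §100 e2: AN-29a ENTAILS `L(W_d,1) ≠ 0` for the MINIMAL model `W_d` from the hypothesis on the naive twist model
(`qd ≠ 0`); harmless (isomorphic models, `entireLFunction_eq_of_isIsogenous`), recorded so the banked docstring can say so. -/
theorem entireLFunction_ne_zero_of_floor (hF : DoorTwinSelmerFloorAtTwo) (W : WeierstrassCurve ℚ) [W.IsElliptic] [W.IsGloballyMinimal]
    (hCM : ¬ W.HasCM) (hT : NoRationalTwoTorsion W) (d : ℤ) (hd : DoorAdmissible W d)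
    (hL : (W.quadraticTwist (d : ℚ)).entireLFunction 1 ≠ 0)
    (Wd : WeierstrassCurve ℚ) [Wd.IsElliptic] [Wd.IsGloballyMinimal] (Cd : WeierstrassCurve.VariableChange ℚ)
    (hmod : Cd • W.quadraticTwist (d : ℚ) = Wd) : Wd.entireLFunction 1 ≠ 0 := by
  obtain ⟨qd, hq, hq0, _, _⟩ := hF W hCM hT d hd hL Wd Cd hmod
  intro h0
  rw [h0, zero_div] at hq
  exact hq0 (by exact_mod_cast hq.symm)

/-- REF1 §100 e3 (rider r4, the parity-sharpened floor): AN-29a(ii) ∧ AN-29c ⇒ the floor is NOT sharp when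
`floorExp W − ord₂∏c(W) − [Δ_W<0]` (= `dim Sel₂(W) − 1`, `floorExp_sub_eq`) is odd,
i.e. for EVEN `dim Sel₂(W)`: there `ord₂ q_d ≥ floorExp W + 1`.  On the headline's slice (`r_an = 1`, `Ш(W)` finite) `dim Sel₂(W)` is
odd and the sharpening never fires — consistent with AN-29b. -/
theorem floorExp_add_one_le_of_floor_of_parity (hF : DoorTwinSelmerFloorAtTwo) (hP : DoorTwinValuationParityAtTwo)
    (W : WeierstrassCurve ℚ) [W.IsElliptic] [W.IsGloballyMinimal]
    (hCM : ¬ W.HasCM) (hT : NoRationalTwoTorsion W) (d : ℤ) (hd : DoorAdmissible W d)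
    (hL : (W.quadraticTwist (d : ℚ)).entireLFunction 1 ≠ 0)
    (Wd : WeierstrassCurve ℚ) [Wd.IsElliptic] [Wd.IsGloballyMinimal] (Cd : WeierstrassCurve.VariableChange ℚ)
    (hmod : Cd • W.quadraticTwist (d : ℚ) = Wd)
    (hodd : Odd (floorExp W - padicValNat 2 W.tamagawaProduct - negBit W)) :
    ∃ qd : ℚ, Wd.entireLFunction 1 / (Wd.realPeriodRat : ℂ) = (qd : ℂ) ∧ qd ≠ 0 ∧ floorExp W + 1 ≤ padicValRat 2 qd := by
  obtain ⟨qd, hq, hq0, _, hfl⟩ := hF W hCM hT d hd hL Wd Cd hmod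
  obtain ⟨qd', hq', _, hev⟩ := hP W hCM hT d hd hL Wd Cd hmod
  have hqq : qd' = qd := by exact_mod_cast hq'.symm.trans hq
  rw [hqq] at hev
  refine ⟨qd, hq, hq0, ?_⟩
  obtain ⟨a, ha⟩ := hev
  obtain ⟨b, hb⟩ := hodd
  omega

/-- REF1 §100 e4: the parity offset in closed form: `floorExp W − ord₂∏c(W) − [Δ_W<0] = dim Sel₂(W) − 1` whenever `Δ_W ≠ 0`. -/
theorem floorExp_sub_eq (W : WeierstrassCurve ℚ) (hΔ : W.Δ ≠ 0) :
    floorExp W - (padicValNat 2 W.tamagawaProduct : ℤ) - (negBit W : ℤ) = (selmerTwoDim W : ℤ) - 1 := by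
  unfold floorExp posBit negBit
  rcases lt_or_gt_of_ne hΔ with h | h
  · rw [if_neg (not_lt.mpr h.le), if_pos h]; push_cast; ring
  · rw [if_pos h, if_neg (not_lt.mpr h.le)]; push_cast; ring

end Summit.BirchSwinnertonDyer.Rank1Residual.F1Sign2.TwinFloor

end
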